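import Literature.AlgebraicGeometry.Motives.RatFnAffine
import Literature.AlgebraicGeometry.Motives.CartierDivisor
import Literature.AlgebraicGeometry.Resolution.RegularLocalRingsUFD
import Literature.RingTheory.RegularLocalRing.QuotientDVR
import Literature.RingTheory.UniqueFactorizationDomain.HeightOnePrimes
import Mathlib.RingTheory.Valuation.ValuationRing
import HarnessLib

/-!
# Regularity of rational functions descends along a surjective morphism onto a regular scheme
# (algebraic Hartogs: `π_* 𝒪_Z ∩ K(Y) = 𝒪_Y` for `Y` locally factorial)

Let `π : Z → Y` be a dominant and surjective morphism of integral schemes (e.g. a proper birational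
morphism, a Chow cover) and let all local rings of `Y` be regular. For a rational function
`h ∈ K(Y)` and an open `W ⊆ Y`, this file PROVES
(`RatFn.isRegularAt_of_forall_isRegularAt_comap`): **if `π^♯ h ∈ K(Z)` is regular at every point
of `π⁻¹W`, then `h` is regular at every point of `W`.** Hence (`CartierDivisor.IsSection.of_pullback`)
a rational function `s` with `π^♯ s ∈ Γ(Z, 𝒪_Z(π^*D))` lies in `Γ(Y, 𝒪_Y(D))` — for `π` birational,
when `π^♯ : K(Y) → K(Z)` is bijective, this is `Γ(Z, π^*𝒪(D)) = Γ(Y, 𝒪(D))`, i.e. the projection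
formula with `π_*𝒪_Z = 𝒪_Y` (Zariski) for sections of line bundles, in the form needed to move
sections from a projective Chow cover back to a smooth non-projective scheme.

The proof is the classical two-step argument (Görtz–Wedhorn I, Thm. 6.45 / Prop. B.73: a normal
noetherian domain is the intersection of its localisations at height-one primes; here through
unique factorisation, Matsumura Thm. 20.3):

* `isRegularAt_of_forall_isRegularAt_comap_of_ringKrullDim_le_one` — **codimension `≤ 1`**: the
  local ring `𝒪_{Y,y}` is then a valuation ring (a field or a discrete valuation ring), so
  `h ∈ 𝒪_{Y,y}` or `h⁻¹ ∈ 𝔪_y`; in the second case, at a point `z` over `y` both `π^♯ h` (by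
  hypothesis) and `π^♯ h⁻¹` are regular, so `π^♯ h⁻¹` is a unit at `z`, and then `h⁻¹` is a unit at
  `y` because the stalk map `𝒪_{Y,y} → 𝒪_{Z,z}` is local — no valuative criterion is needed, only a
  point of `Z` over `y`;
* `isRegularAt_of_forall_isRegularAt_comap` — **all points**: `𝒪_{Y,y}` is factorial
  (`IsRegularLocalRing.uniqueFactorizationMonoid`, `Literature/AlgebraicGeometry/Resolution/RegularLocalRingsUFD`),
  hence the intersection of its localisations `(𝒪_{Y,y})_{(ϖ)}` at prime elements
  (`Literature.RingTheory.UniqueFactorizationDomain.exists_algebraMap_eq_of_forall_prime`), and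
  `(𝒪_{Y,y})_{(ϖ)}` is the local ring at the codimension-one generization `y_ϖ ∈ W` of `y`, where
  the first step applies (read on an affine chart: `RatFn.isRegularAt_iff_exists`,
  `Motives/RatFnAffine`).

Everything is proved; no named facts. Mathlib searched (pin): `ValuationRing.isInteger_or_isInteger`,
`ValuationRing.iff_local_bezout_domain`, `IsLocalization.height_under`,
`Ideal.height_le_one_of_isPrincipal_of_mem_minimalPrimes` (used); Mathlib has no Hartogs-type statement for schemes.

## References

* U. Görtz, T. Wedhorn, *Algebraic Geometry I: Schemes*, 2nd ed. (2020): Thm. 6.45 (p. 203);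
  Prop. B.73 (3) and Remark B.78 (pp. 571–572). [GortzWedhorn2020]
* H. Matsumura, *Commutative Ring Theory*, CSAM 8 (1986): Thm. 11.5, Thm. 20.3. [Matsumura1987]
-/

universe u

open CategoryTheory AlgebraicGeometry TopologicalSpace IsLocalRing Ideal
open Literature.RingTheory.UniqueFactorizationDomain

noncomputable section

namespace Literature.AlgebraicGeometry.Motives

namespace RatFn

variable {Z Y : Scheme.{u}} [IsIntegral Z] [IsIntegral Y] (π : Z ⟶ Y) [IsDominant π]

/-- Regularity of `h` at `x` is integrality of `h ∈ K(X) = Frac 𝒪_{X,x}` over `𝒪_{X,x}`.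
[folklore] -/
theorem isRegularAt_iff_isInteger {X : Scheme.{u}} [IsIntegral X] (x : X) (h : X.functionField) :
    IsRegularAt x h ↔ IsLocalization.IsInteger (X.presheaf.stalk x) h := by
  constructor
  · rintro ⟨t, rfl⟩; exact ⟨t, rfl⟩
  · rintro ⟨t, rfl⟩; exact ⟨t, rfl⟩

/-- A regular local ring of dimension `≤ 1` is a valuation ring (a field or a DVR). [folklore] -/
theorem valuationRing_of_isRegularLocalRing_of_ringKrullDim_le_one (R : Type u) [CommRing R]
    [IsDomain R] [IsRegularLocalRing R] (h : ringKrullDim R ≤ 1) : ValuationRing R := by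
  haveI : IsPrincipalIdealRing R :=
    Literature.AlgebraicGeometry.Resolution.isPrincipalIdealRing_of_ringKrullDim_le_one h
  exact (ValuationRing.iff_local_bezout_domain (R := R)).mpr ⟨inferInstance, inferInstance⟩

/-- **Codimension `≤ 1`**: let `π : Z → Y` be dominant and surjective, `y ∈ Y` a point with
`𝒪_{Y,y}` regular of dimension `≤ 1`, and `h ∈ K(Y)` such that `π^♯ h` is regular at every point over
`y`. Then `h` is regular at `y`: `𝒪_{Y,y}` is a valuation ring, so otherwise `h⁻¹ ∈ 𝔪_y`; at a point
`z` over `y`, `π^♯ h` and `π^♯ h⁻¹` are both regular, so `π^♯ h⁻¹` is a unit, and `h⁻¹` is a unit at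
`y` as the stalk map is local — contradiction. [cite: GortzWedhorn2020, Thm. 6.45 (p. 203)] -/
theorem isRegularAt_of_forall_isRegularAt_comap_of_ringKrullDim_le_one [Surjective π] {y : Y}
    (hreg : IsRegularLocalRing (Y.presheaf.stalk y)) (hdim : ringKrullDim (Y.presheaf.stalk y) ≤ 1)
    {h : Y.functionField} (hh : ∀ z : Z, π z = y → IsRegularAt z (functionFieldMap π h)) :
    IsRegularAt y h := by
  by_cases h0 : h = 0
  · rw [h0]; exact isRegularAt_zero
  haveI := Literature.AlgebraicGeometry.Resolution.isDomain_of_isRegularLocalRing (Y.presheaf.stalk y)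
  haveI := valuationRing_of_isRegularLocalRing_of_ringKrullDim_le_one (Y.presheaf.stalk y) hdim
  rcases ValuationRing.isInteger_or_isInteger (Y.presheaf.stalk y) h with hint | hint
  · exact (isRegularAt_iff_isInteger y h).mpr hint
  · have hinv : IsRegularAt y h⁻¹ := (isRegularAt_iff_isInteger y h⁻¹).mpr hint
    obtain ⟨z, hz⟩ := π.surjective y
    subst hz
    have h1 : IsRegularAt z (functionFieldMap π h⁻¹) := hinv.functionFieldMap
    have h2 : IsUnitAt z (functionFieldMap π h⁻¹) := by
      rw [isUnitAt_iff]
      refine ⟨by rw [map_inv₀]; exact inv_ne_zero ((map_ne_zero _).2 h0), h1, ?_⟩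
      rw [map_inv₀, inv_inv]
      exact hh z rfl
    have h3 : IsUnitAt (π z) h⁻¹ := hinv.isUnitAt_of_functionFieldMap h2
    simpa using h3.inv.isRegularAt

/-- **Algebraic Hartogs along a surjection, on an affine chart**: let `π : Z → Y` be dominant and
surjective between integral schemes, all local rings of `Y` regular, `V ⊆ Y` an affine open and
`h ∈ K(Y)` with `π^♯ h` regular at every point of `π⁻¹V`. Then `h` is regular at every point of `V`.
Proof: `𝒪_{Y,y}` is factorial (Auslander–Buchsbaum–Nagata, Matsumura Thm. 20.3), so it suffices that
`h ∈ (𝒪_{Y,y})_{(ϖ)}` for every prime element `ϖ`; this localisation is the local ring of the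
codimension-one generization `y_ϖ ∈ V` of `y`, where `h` is regular by the codimension-one case.
[cite: GortzWedhorn2020, Prop. B.73 (3) (p. 571)] [cite: Matsumura1987, Thm. 20.3] -/
theorem isRegularAt_of_forall_isRegularAt_comap_affine [Surjective π]
    (hY : ∀ y : Y, IsRegularLocalRing (Y.presheaf.stalk y)) {V : Y.Opens} (hV : IsAffineOpen V)
    {h : Y.functionField} (hh : ∀ z : Z, π z ∈ V → IsRegularAt z (functionFieldMap π h)) (y : V) :
    IsRegularAt (y : Y) h := by
  classical
  haveI : Nonempty V := ⟨y⟩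
  haveI : IsRegularLocalRing (Y.presheaf.stalk (y : Y)) := hY y
  haveI := Literature.AlgebraicGeometry.Resolution.isDomain_of_isRegularLocalRing
    (Y.presheaf.stalk (y : Y))
  haveI : UniqueFactorizationMonoid (Y.presheaf.stalk (y : Y)) :=
    Literature.AlgebraicGeometry.Resolution.IsRegularLocalRing.uniqueFactorizationMonoid _
  haveI := hV.isLocalization_stalk y
  -- Hartogs for the factorial ring `𝒪_{Y,y}`
  suffices hx : ∀ ϖ : Y.presheaf.stalk (y : Y), Prime ϖ → ∃ d e : Y.presheaf.stalk (y : Y),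
      ¬ ϖ ∣ e ∧ h * toFunctionField (y : Y) e = toFunctionField (y : Y) d by
    obtain ⟨r, hr⟩ := exists_algebraMap_eq_of_forall_prime (R := Y.presheaf.stalk (y : Y)) h hx
    exact ⟨r, hr⟩
  intro ϖ hϖ
  -- the height-one prime `(ϖ)` and its trace `p` on `Γ(Y, V)`; the point `y' = y_ϖ`
  haveI hϖp : (span {ϖ} : Ideal (Y.presheaf.stalk (y : Y))).IsPrime :=
    (span_singleton_prime hϖ.ne_zero).2 hϖ
  have hϖ1 : (span {ϖ} : Ideal (Y.presheaf.stalk (y : Y))).height ≤ 1 :=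
    height_le_one_of_isPrincipal_of_mem_minimalPrimes (span {ϖ}) (span {ϖ})
      (by rw [Ideal.minimalPrimes_eq_subsingleton_self]; exact Set.mem_singleton _)
  set p : Ideal Γ(Y, V) := (span {ϖ} : Ideal (Y.presheaf.stalk (y : Y))).under Γ(Y, V) with hp
  haveI hpp : p.IsPrime := IsPrime.under _ _
  obtain ⟨y', hpy'⟩ : ∃ y' : V, hV.primeIdealOf y' = ⟨p, hpp⟩ :=
    ⟨⟨hV.fromSpec ⟨p, hpp⟩, hV.range_fromSpec.le ⟨_, rfl⟩⟩, by
      apply hV.fromSpec.isOpenEmbedding.injective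
      rw [hV.fromSpec_primeIdealOf]⟩
  -- `𝒪_{Y,y'}` has dimension `= ht p = ht (ϖ) ≤ 1`
  haveI := hV.isLocalization_stalk y'
  have hdim : ringKrullDim (Y.presheaf.stalk (y' : Y)) ≤ 1 := by
    rw [IsLocalization.AtPrime.ringKrullDim_eq_height (hV.primeIdealOf y').asIdeal
      (Y.presheaf.stalk (y' : Y)), hpy']
    change ((p.height : ℕ∞) : WithBot ℕ∞) ≤ 1
    rw [hp, IsLocalization.height_under (hV.primeIdealOf y).asIdeal.primeCompl
      (span {ϖ} : Ideal (Y.presheaf.stalk (y : Y)))]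
    exact_mod_cast hϖ1
  -- so `h` is regular at `y'`
  have hreg' : IsRegularAt (y' : Y) h :=
    isRegularAt_of_forall_isRegularAt_comap_of_ringKrullDim_le_one π (hY y') hdim
      (fun z hz => hh z (by rw [hz]; exact y'.2))
  -- read off a denominator not divisible by `ϖ`
  obtain ⟨a, b, hb, e⟩ := (isRegularAt_iff_exists hV y' h).1 hreg'
  rw [hpy'] at hb
  refine ⟨algebraMap Γ(Y, V) _ a, algebraMap Γ(Y, V) _ b, fun hdvd => hb ?_, ?_⟩
  · exact mem_comap.2 (mem_span_singleton.2 hdvd)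
  · rw [toFunctionField_algebraMap_stalk, toFunctionField_algebraMap_stalk, e]

/-- **Algebraic Hartogs along a surjection**: let `π : Z → Y` be dominant and surjective between
integral schemes, all local rings of `Y` regular, `W ⊆ Y` open and `h ∈ K(Y)` with `π^♯ h` regular at
every point of `π⁻¹W`. Then `h` is regular at every point of `W` (take an affine open `y ∈ V ⊆ W`).
[cite: GortzWedhorn2020, Thm. 6.45 (p. 203)] -/
theorem isRegularAt_of_forall_isRegularAt_comap [Surjective π]
    (hY : ∀ y : Y, IsRegularLocalRing (Y.presheaf.stalk y)) {W : Y.Opens} {h : Y.functionField}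
    (hh : ∀ z : Z, π z ∈ W → IsRegularAt z (functionFieldMap π h)) {y : Y} (hy : y ∈ W) :
    IsRegularAt y h := by
  obtain ⟨V, hV, hyV, hVW⟩ := exists_isAffineOpen_mem_and_subset (U := W) hy
  exact isRegularAt_of_forall_isRegularAt_comap_affine π hY hV
    (fun z hz => hh z (hVW hz)) ⟨y, hyV⟩

end RatFn

/-! ### Sections of `𝒪(D)` whose pullback is a section of `𝒪(π^*D)` -/

namespace CartierDivisor

open RatFn

variable {Z Y : Scheme.{u}} [IsIntegral Z] [IsIntegral Y] (π : Z ⟶ Y) [IsDominant π] [Surjective π]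

/-- **A rational function `s` on `Y` such that `π^♯ s` is a global section of `𝒪_Z(π^*D)` is a global
section of `𝒪_Y(D)`**, for `π : Z → Y` dominant and surjective and `Y` with regular local rings
(algebraic Hartogs, `RatFn.isRegularAt_of_forall_isRegularAt_comap`, applied to `f_i s` on `U_i`).
For `π` birational (e.g. a Chow cover of a smooth variety) this says
`Γ(Z, 𝒪(π^*D)) = Γ(Y, 𝒪(D))`. [cite: GortzWedhorn2020, Thm. 6.45 (p. 203)] -/
theorem IsSection.of_pullback (hY : ∀ y : Y, IsRegularLocalRing (Y.presheaf.stalk y))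
    (D : CartierDivisor Y) {s : Y.functionField}
    (hs : (D.pullback π).IsSection (functionFieldMap π s)) : D.IsSection s := by
  intro i y hy
  refine isRegularAt_of_forall_isRegularAt_comap π hY (W := D.U i) (h := D.f i * s)
    (fun z hz => ?_) hy
  have := hs i z hz
  rwa [pullback_f, ← map_mul] at this

end CartierDivisor

end Literature.AlgebraicGeometry.Motives

end
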